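import Summits.CriticalPhenomena.PercolationContinuityZ3.Theorems.PercNearOneGluingNoHeavyLowerTailSahiCombMinDegree
import Summits.CriticalPhenomena.PercolationContinuityZ3.Theorems.PercNearOneGluingNoHeavyLowerTailSahiCombUnique
import Summits.CriticalPhenomena.PercolationContinuityZ3.Theorems.PercNearOneGluingNoHeavyLowerTailSahiCombTensorisation
import Literature.Combinatorics.Sahi2008.SetPartitionForm

/-!
# The comb hierarchy for Sahi's `E_k`: the HYBRID-READING KERNEL, I — hybrid configurations, the rewiring involution and the
# hybrid replica lemma (every family of events)

Support file of the one-cut programme (crux `NoHeavyLowerTail`, stmt-CriticalPhenomena-4575; cell `prim-masterthm`, seat P5 gen 5;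
report `P5-LORENTZIAN-TEST.md` §10).  The row (M⁺⁺-k) (`SahiComb.MasterFamilyCombMinDegPos`, file `…SahiCombMinDegree`) is typed
EXISTENTIALLY ("`p ↦ E_k(μ_p; 1_U)` has SOME nonnegative tensor-Bernstein representation at the minimal multidegree
`r_e = #{i : e ∈ esupp U_i}`").  This file and its companion `…SahiCombHybridCoeff` construct THE coefficients, uniformly in `k`
and for every family.  Here:

* `SahiHybrid.hybrid E B ω` — the **hybrid configuration** of a block `B ⊆ [k]` of members built from `k` copies
  `ω : Fin k → Set ι`: coordinate `e` is read from the copy of the LARGEST member of `B` whose declared support `E i ∋ e`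
  (no such member ⇒ `e` is irrelevant for `⋂_{i∈B} U_i` and is read as closed);
* `SahiHybrid.kernel E U ω = Σ_π (−1)^{|π|−1} ∏_{B∈π} (|B|−1)!·∏_{i∈B} 1_{U_i}(hybrid_B(ω))` — Sahi's set-partition formula
  [Sahi 2008, eq. (7); tree `sahiE_eq_sahiESetPartition`] evaluated, block by block, on the hybrids;
* `SahiHybrid.src`, `SahiHybrid.rewire` — the REWIRING involution of the copy space (inside each block, at each coordinate, swap the
  representative's bit with the reader's bit): measure-preserving (`prod_bernoulliWeight_rewire`) and turning the hybrid of every block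
  into the copy of its representative (`mem_hybrid_iff_mem_rewire_rep`); hence **`sum_weight_prod_hybrid`**: the hybrids of the
  blocks of ONE partition are independent with law `μ_p` on the coordinates they read;
* **`SahiHybrid.sahiE_eq_sum_kernel`** (HYBRID REPLICA LEMMA): if each `U_i` is determined by `E i` then
  `E_k(μ_p; 1_U) = Σ_ω (∏_c μ_p(ω_c))·kernel E U ω`.
The kernel reads coordinate `e` only from the copies indexed by `{i : e ∈ E i}` — `|{i : e ∈ E i}|` of them, the minimal degree;
the companion file groups by the reduced profile and extracts the explicit (M⁺⁺) coefficients.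
Everything here is proved; axioms standard.  HONEST LABEL: identities; (M⁺⁺-k)/(M⁺-k)/`C_k` stay OPEN for `k ≥ 3`. [this work]
-/

noncomputable section

open scoped Classical

namespace Summit.CriticalPhenomena.PercolationContinuityZ3.Theorems

open Finset Function
open Literature.Combinatorics.Sahi2008
open Literature.Combinatorics.Sahi2008.PartitionForm (block mem_block card_block term factor)
open Literature.Probability.Percolation (DeterminedBy determinedBy_iff)
open Literature.Probability.Percolation.DecisionTree (ind ind_of_mem ind_of_not_mem ind_nonneg)
open Literature.Probability.Percolation.BHK2006 (weight)
open SahiComb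

namespace SahiHybrid

variable {ι : Type} {k : ℕ}

/-! ### Slots, readers and hybrid configurations -/

/-- The members whose declared support contains the coordinate `e`. [this work] -/
def slot (E : Fin k → Finset ι) (e : ι) : Finset (Fin k) := univ.filter fun i => e ∈ E i

/-- Membership in a slot. [this work] -/
@[simp] theorem mem_slot {E : Fin k → Finset ι} {e : ι} {i : Fin k} : i ∈ slot E e ↔ e ∈ E i := by
  simp [slot]

/-- **Hybrid configuration** of a set `B` of members, built from the copies `ω`: coordinate `e` is read from the copy of the
largest member of `B` interested in `e`; coordinates no member of `B` is interested in are read as closed. [this work] -/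
def hybrid (E : Fin k → Finset ι) (B : Finset (Fin k)) (ω : Fin k → Set ι) : Set ι :=
  {e | ∃ h : (B ∩ slot E e).Nonempty, e ∈ ω ((B ∩ slot E e).max' h)}

/-- Membership in a hybrid configuration at a coordinate some member of `B` is interested in. [this work] -/
theorem mem_hybrid_iff {E : Fin k → Finset ι} {B : Finset (Fin k)} {ω : Fin k → Set ι} {e : ι}
    (h : (B ∩ slot E e).Nonempty) : e ∈ hybrid E B ω ↔ e ∈ ω ((B ∩ slot E e).max' h) := by
  constructor
  · rintro ⟨h', he⟩; exact he
  · intro he; exact ⟨h, he⟩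

/-- At a coordinate no member of `B` is interested in, the hybrid is closed. [this work] -/
theorem not_mem_hybrid {E : Fin k → Finset ι} {B : Finset (Fin k)} {ω : Fin k → Set ι} {e : ι}
    (h : ¬ (B ∩ slot E e).Nonempty) : e ∉ hybrid E B ω := by
  rintro ⟨h', _⟩; exact h h'

/-- The reader of `B` at `e` is a member of `B` interested in `e`. [this work] -/
theorem max'_mem_inter {E : Fin k → Finset ι} {B : Finset (Fin k)} {e : ι} (h : (B ∩ slot E e).Nonempty) :
    (B ∩ slot E e).max' h ∈ B ∧ e ∈ E ((B ∩ slot E e).max' h) := by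
  have hm := Finset.max'_mem _ h
  rw [mem_inter, mem_slot] at hm
  exact hm

/-! ### The hybrid kernel -/

/-- **The hybrid-reading kernel**: Sahi's set-partition formula `Σ_π (−1)^{|π|−1} ∏_{B∈π} (|B|−1)!·∏_{i∈B} 1_{U_i}` [Sahi 2008,
eq. (7)] evaluated, block by block, on the hybrid configurations of the blocks. [this work] -/
def kernel (E : Fin k → Finset ι) (U : Fin k → Set (Set ι)) (ω : Fin k → Set ι) : ℝ :=
  ∑ c : OrderedFinpartition k, (-1 : ℝ) ^ (c.length - 1) *
    ∏ m : Fin c.length, (((c.partSize m - 1).factorial : ℝ) * ∏ i ∈ block c m, ind (U i) (hybrid E (block c m) ω))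

/-! ### Blocks of an ordered finpartition: representatives and indices -/

section Blocks

variable (c : OrderedFinpartition k)

/-- Membership in a block is having that block index. [folklore] -/
theorem mem_block_iff_index {m : Fin c.length} {x : Fin k} : x ∈ block c m ↔ c.index x = m := by
  simp [block]

/-- The index of an enumerated point of block `m` is `m`. [folklore] -/
theorem index_emb (m : Fin c.length) (r : Fin (c.partSize m)) : c.index (c.emb m r) = m := by
  have h := c.equivSigma.symm_apply_apply ⟨m, r⟩
  have h' : c.equivSigma.symm (c.emb m r) = ⟨c.index (c.emb m r), c.invEmbedding (c.emb m r)⟩ := rfl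
  rw [show c.equivSigma ⟨m, r⟩ = c.emb m r from rfl, h'] at h
  exact congrArg Sigma.fst h

/-- The representative (first point) of block `m`. [this work] -/
def rep (m : Fin c.length) : Fin k := c.emb m ⟨0, c.partSize_pos m⟩

/-- The representative of block `m` has index `m`. [folklore] -/
@[simp] theorem index_rep (m : Fin c.length) : c.index (rep c m) = m := index_emb c m _

/-- The representative lies in its block. [folklore] -/
theorem rep_mem_block (m : Fin c.length) : rep c m ∈ block c m := (mem_block_iff_index c).2 (index_rep c m)

/-- `rep` is injective. [folklore] -/
theorem rep_injective : Injective (rep c) := fun m m' h => by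
  have := congrArg c.index h
  simpa using this

end Blocks

/-! ### The rewiring involution -/

section Rewire

variable (E : Fin k → Finset ι) (c : OrderedFinpartition k)

/-- The copy whose bit at `e` is moved to position `x` by the rewiring: inside the block of `x`, the representative and the
reader at `e` are swapped; everything else stays. [this work] -/
def src (e : ι) (x : Fin k) : Fin k :=
  if h : (block c (c.index x) ∩ slot E e).Nonempty then
    (if x = rep c (c.index x) then (block c (c.index x) ∩ slot E e).max' h
      else if x = (block c (c.index x) ∩ slot E e).max' h then rep c (c.index x) else x)
  else x

/-- The reader of the block of index `m` at `e` has index `m`. [this work] -/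
theorem index_max' {e : ι} {m : Fin c.length} (h : (block c m ∩ slot E e).Nonempty) :
    c.index ((block c m ∩ slot E e).max' h) = m :=
  (mem_block_iff_index c).1 (max'_mem_inter h).1

/-- `src e` preserves block indices. [this work] -/
theorem index_src (e : ι) (x : Fin k) : c.index (src E c e x) = c.index x := by
  unfold src
  split_ifs with h h1 h2
  · exact index_max' E c h
  · exact index_rep c _
  · rfl
  · rfl

/-- On the representative of block `m` (reader defined) `src` returns the reader. [this work] -/
theorem src_rep {e : ι} {m : Fin c.length} (h : (block c m ∩ slot E e).Nonempty) :
    src E c e (rep c m) = (block c m ∩ slot E e).max' h := by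
  unfold src
  simp [index_rep, dif_pos h]

/-- `src e` is an involution. [this work] -/
theorem src_involutive (e : ι) : Involutive (src E c e) := by
  intro x
  set m := c.index x with hm
  have hidx : c.index (src E c e x) = m := index_src E c e x
  by_cases h : (block c m ∩ slot E e).Nonempty
  · -- inside block `m` the representative and the reader are swapped
    set rd := (block c m ∩ slot E e).max' h with hrd
    have hsrc : ∀ y : Fin k, c.index y = m →
        src E c e y = (if y = rep c m then rd else if y = rd then rep c m else y) := by
      intro y hy
      unfold src
      rw [hy, dif_pos h]
    by_cases h1 : x = rep c m
    · rw [hsrc x hm.symm, if_pos h1, hsrc rd (index_max' E c h)]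
      by_cases h3 : rd = rep c m
      · rw [if_pos h3, h1]; exact h3
      · rw [if_neg h3, if_pos rfl, h1]
    · by_cases h2 : x = rd
      · rw [hsrc x hm.symm, if_neg h1, if_pos h2, hsrc (rep c m) (index_rep c m), if_pos rfl, h2]
      · rw [hsrc x hm.symm, if_neg h1, if_neg h2, hsrc x hm.symm, if_neg h1, if_neg h2]
  · have hfix : ∀ y : Fin k, c.index y = m → src E c e y = y := by
      intro y hy
      unfold src
      rw [hy, dif_neg h]
    rw [hfix x hm.symm, hfix x hm.symm]

/-- The rewiring map on copies: position `x` receives, at each coordinate `e`, the bit of copy `src e x`. [this work] -/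
def rewire (ω : Fin k → Set ι) : Fin k → Set ι := fun x => {e | e ∈ ω (src E c e x)}

/-- The rewiring is an involution (hence a bijection of the copy space). [this work] -/
theorem rewire_involutive : Involutive (rewire E c) := by
  intro ω
  funext x
  ext e
  simp only [rewire, Set.mem_setOf_eq]
  rw [src_involutive E c e x]

variable [Fintype ι]

/-- The product weight of `k` copies is a product over (copy, coordinate) pairs. [folklore] -/
theorem prod_bernoulliWeight_eq (p : ι → unitInterval) (ω : Fin k → Set ι) :
    ∏ x, bernoulliWeight p (ω x) = ∏ e, ∏ x, (if e ∈ ω x then (p e : ℝ) else 1 - p e) := by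
  rw [Finset.prod_comm]
  rfl

/-- **The rewiring preserves the product weight** (at each coordinate it permutes the copies). [this work] -/
theorem prod_bernoulliWeight_rewire (p : ι → unitInterval) (ω : Fin k → Set ι) :
    ∏ x, bernoulliWeight p (rewire E c ω x) = ∏ x, bernoulliWeight p (ω x) := by
  rw [prod_bernoulliWeight_eq, prod_bernoulliWeight_eq]
  refine prod_congr rfl fun e _ => ?_
  simp only [rewire, Set.mem_setOf_eq]
  exact (src_involutive E c e).bijective.prod_comp fun x => if e ∈ ω x then (p e : ℝ) else 1 - p e

omit [Fintype ι] in
/-- **The rewired representative sees the hybrid**: at every coordinate some member of block `m` is interested in, the hybrid of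
block `m` and the rewired copy at the representative of `m` agree. [this work] -/
theorem mem_hybrid_iff_mem_rewire_rep {ω : Fin k → Set ι} {m : Fin c.length} {e : ι}
    (h : (block c m ∩ slot E e).Nonempty) : e ∈ hybrid E (block c m) ω ↔ e ∈ rewire E c ω (rep c m) := by
  rw [mem_hybrid_iff h]
  simp only [rewire, Set.mem_setOf_eq]
  rw [src_rep E c h]

end Rewire

/-! ### The key lemma: hybrids of the blocks of a partition are independent with law `μ_p` -/

section Key

variable (E : Fin k → Finset ι) (c : OrderedFinpartition k)

/-- The coordinates some member of block `m` is interested in. [this work] -/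
def dom (m : Fin c.length) : Set ι := {e | (block c m ∩ slot E e).Nonempty}

variable [Fintype ι]

/-- Fubini over the copies for functions of the representatives' copies only. [folklore] -/
theorem sum_prod_weight_mul_prod_rep (μ : Set ι → ℝ) (hμ : ∑ x, μ x = 1) (g : Fin c.length → Set ι → ℝ) :
    ∑ ω : Fin k → Set ι, (∏ x, μ (ω x)) * ∏ m, g m (ω (rep c m)) = ∏ m, ex μ (g m) := by
  -- write the product over blocks as a product over copies
  let G : Fin k → Set ι → ℝ := fun x s => if rep c (c.index x) = x then g (c.index x) s else 1
  have hG : ∀ ω : Fin k → Set ι, ∏ m, g m (ω (rep c m)) = ∏ x, G x (ω x) := by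
    intro ω
    have h1 : ∏ x, G x (ω x) = ∏ x ∈ univ.filter (fun x => rep c (c.index x) = x), g (c.index x) (ω x) := by
      rw [prod_filter]
    have h2 : univ.filter (fun x : Fin k => rep c (c.index x) = x) = univ.image (rep c) := by
      ext x
      simp only [mem_filter, mem_univ, true_and, mem_image]
      constructor
      · intro hx; exact ⟨c.index x, hx⟩
      · rintro ⟨m, rfl⟩; rw [index_rep]
    rw [h1, h2, prod_image fun m _ m' _ h => rep_injective c h]
    refine prod_congr rfl fun m _ => by rw [index_rep]
  have hG' : ∀ x : Fin k, ∑ s, μ s * G x s = if rep c (c.index x) = x then ex μ (g (c.index x)) else 1 := by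
    intro x
    by_cases hx : rep c (c.index x) = x
    · simp only [G, if_pos hx, ex_def]
    · simp only [G, if_neg hx, mul_one, hμ]
  calc ∑ ω : Fin k → Set ι, (∏ x, μ (ω x)) * ∏ m, g m (ω (rep c m))
      = ∑ ω : Fin k → Set ι, ∏ x, (μ (ω x) * G x (ω x)) := by
        refine sum_congr rfl fun ω _ => ?_
        rw [hG ω, prod_mul_distrib]
    _ = ∏ x, ∑ s, μ s * G x s := (Fintype.prod_sum (fun x s => μ s * G x s)).symm
    _ = ∏ x ∈ univ.filter (fun x => rep c (c.index x) = x), ex μ (g (c.index x)) := by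
        rw [prod_filter]
        exact prod_congr rfl fun x _ => hG' x
    _ = ∏ m, ex μ (g m) := by
        have h2 : univ.filter (fun x : Fin k => rep c (c.index x) = x) = univ.image (rep c) := by
          ext x
          simp only [mem_filter, mem_univ, true_and, mem_image]
          constructor
          · intro hx; exact ⟨c.index x, hx⟩
          · rintro ⟨m, rfl⟩; rw [index_rep]
        rw [h2, prod_image fun m _ m' _ h => rep_injective c h]
        exact prod_congr rfl fun m _ => by rw [index_rep]

/-- **Key lemma.** For functions `g_m` reading only the coordinates some member of block `m` is interested in,
`Σ_ω (∏_c μ_p(ω_c))·∏_m g_m(hybrid_m(ω)) = ∏_m E_{μ_p}[g_m]`: the hybrids of the blocks of ONE partition are independent, each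
with law `μ_p` on the coordinates it reads. [this work] -/
theorem sum_weight_prod_hybrid (p : ι → unitInterval) (g : Fin c.length → Set ι → ℝ)
    (hg : ∀ m (x y : Set ι), (∀ e ∈ dom E c m, (e ∈ x ↔ e ∈ y)) → g m x = g m y) :
    ∑ ω : Fin k → Set ι, (∏ x, bernoulliWeight p (ω x)) * ∏ m, g m (hybrid E (block c m) ω)
      = ∏ m, ex (bernoulliWeight p) (g m) := by
  have hstep : ∀ ω : Fin k → Set ι,
      (∏ x, bernoulliWeight p (ω x)) * ∏ m, g m (hybrid E (block c m) ω)
        = (∏ x, bernoulliWeight p (rewire E c ω x)) * ∏ m, g m (rewire E c ω (rep c m)) := by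
    intro ω
    rw [prod_bernoulliWeight_rewire]
    congr 1
    refine prod_congr rfl fun m _ => hg m _ _ fun e he => ?_
    exact mem_hybrid_iff_mem_rewire_rep E c he
  calc ∑ ω : Fin k → Set ι, (∏ x, bernoulliWeight p (ω x)) * ∏ m, g m (hybrid E (block c m) ω)
      = ∑ ω : Fin k → Set ι, (fun ω' => (∏ x, bernoulliWeight p (ω' x)) * ∏ m, g m (ω' (rep c m))) (rewire E c ω) :=
        sum_congr rfl fun ω _ => hstep ω
    _ = ∑ ω : Fin k → Set ι, (∏ x, bernoulliWeight p (ω x)) * ∏ m, g m (ω (rep c m)) :=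
        (rewire_involutive E c).bijective.sum_comp
          (fun ω' => (∏ x, bernoulliWeight p (ω' x)) * ∏ m, g m (ω' (rep c m)))
    _ = ∏ m, ex (bernoulliWeight p) (g m) := sum_prod_weight_mul_prod_rep c _ (sum_bernoulliWeight p) g

end Key

/-! ### The hybrid replica lemma -/

section Replica

variable (E : Fin k → Finset ι)

/-- Configurations agreeing on the coordinates read by block `m` agree on every `U_i`, `i` in the block, when `U_i` is determined
by `E i`. [this work] -/
theorem prod_ind_eq_of_agree (c : OrderedFinpartition k) {U : Fin k → Set (Set ι)} (hU : ∀ i, DeterminedBy (U i) ↑(E i))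
    (m : Fin c.length) (x y : Set ι) (hxy : ∀ e ∈ dom E c m, (e ∈ x ↔ e ∈ y)) :
    ∏ i ∈ block c m, ind (U i) x = ∏ i ∈ block c m, ind (U i) y := by
  refine prod_congr rfl fun i hi => ?_
  have hdet : x ∩ ↑(E i) = y ∩ ↑(E i) := by
    ext e
    simp only [Set.mem_inter_iff, mem_coe]
    constructor
    · rintro ⟨hex, he⟩
      exact ⟨(hxy e ⟨i, mem_inter.2 ⟨hi, mem_slot.2 he⟩⟩).1 hex, he⟩
    · rintro ⟨hey, he⟩
      exact ⟨(hxy e ⟨i, mem_inter.2 ⟨hi, mem_slot.2 he⟩⟩).2 hey, he⟩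
  have hiff : x ∈ U i ↔ y ∈ U i := (determinedBy_iff (U i) _).1 (hU i) x y hdet
  by_cases hx : x ∈ U i
  · rw [ind_of_mem hx, ind_of_mem (hiff.1 hx)]
  · rw [ind_of_not_mem hx, ind_of_not_mem fun hy => hx (hiff.2 hy)]

variable [Fintype ι]

/-- **Hybrid replica lemma.**  If every `U_i` is determined by its declared support `E i`, then Sahi's `E_k(μ_p; 1_U)` is the
expectation of the hybrid kernel under `k` independent copies of `μ_p`:
`E_k(μ_p; 1_U) = Σ_ω (∏_c μ_p(ω_c))·kernel E U ω`. [this work] -/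
theorem sahiE_eq_sum_kernel (p : ι → unitInterval) (U : Fin (k + 1) → Set (Set ι)) (E : Fin (k + 1) → Finset ι)
    (hU : ∀ i, DeterminedBy (U i) ↑(E i)) :
    sahiE (bernoulliWeight p) (k + 1) (fun i => ind (U i))
      = ∑ ω : Fin (k + 1) → Set ι, (∏ x, bernoulliWeight p (ω x)) * kernel E U ω := by
  rw [sahiE_eq_sahiESetPartition, sahiESetPartition_eq_sum_term]
  unfold kernel
  simp_rw [Finset.mul_sum]
  rw [Finset.sum_comm]
  refine sum_congr rfl fun c _ => ?_
  -- one set partition `c`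
  have hkey := sum_weight_prod_hybrid E c p (fun m x => ∏ i ∈ block c m, ind (U i) x)
    (fun m x y hxy => prod_ind_eq_of_agree E c hU m x y hxy)
  unfold term factor
  calc (-1 : ℝ) ^ (c.length - 1) * ∏ m, (((c.partSize m - 1).factorial : ℝ) * ex (bernoulliWeight p) (∏ i ∈ block c m, ind (U i)))
      = (-1 : ℝ) ^ (c.length - 1) * ((∏ m, ((c.partSize m - 1).factorial : ℝ)) *
          ∑ ω : Fin (k + 1) → Set ι, (∏ x, bernoulliWeight p (ω x)) * ∏ m, ∏ i ∈ block c m, ind (U i) (hybrid E (block c m) ω)) := by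
        rw [hkey, ← prod_mul_distrib]
        refine congrArg _ (prod_congr rfl fun m _ => ?_)
        congr 1
        refine congrArg _ (funext fun x => ?_)
        rw [Finset.prod_apply]
    _ = ∑ ω : Fin (k + 1) → Set ι, (∏ x, bernoulliWeight p (ω x)) *
          ((-1 : ℝ) ^ (c.length - 1) * ∏ m, (((c.partSize m - 1).factorial : ℝ) * ∏ i ∈ block c m, ind (U i) (hybrid E (block c m) ω))) := by
        rw [Finset.mul_sum, Finset.mul_sum]
        refine sum_congr rfl fun ω _ => ?_
        rw [prod_mul_distrib]
        ring

end Replica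

end SahiHybrid

end Summit.CriticalPhenomena.PercolationContinuityZ3.Theorems
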